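import Mathlib.Geometry.Manifold.IsManifold.ExtChartAt
import Mathlib.Geometry.Manifold.ContMDiff.Atlas
import Mathlib.Geometry.Manifold.ContMDiff.NormedSpace
import Literature.ModelTheory.ExponentialFields.RealAnExpSubanalytic
import HarnessLib

/-!
# A topological embedding of a compact real-analytic manifold into `ℝᴺ` with `ℝ_an,exp`-definable
images of analytically parametrised definable sets

Proof file (theorems only). For a compact Hausdorff boundaryless real-analytic manifold `M` (any
model with corners `I` on a finite-dimensional `E`) we build, from finitely many extended charts
`ψⱼ = L ∘ extChartAt I xⱼ : M → ℝⁿ` (`L : E ≃ ℝⁿ` linear) and the continuous SEMIALGEBRAIC bump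
functions `bⱼ = Θ(qⱼ(ψⱼ)/ρⱼ²)` (`qⱼ(u) = ∑ (uᵢ - ψⱼ(xⱼ)ᵢ)²`, `Θ(s) = max 0 (min 1 (4(1-s)/3))`, extended by
`0` off the chart domain), the classical injective continuous map
`F = (bⱼ, bⱼ · ψⱼ)ⱼ : M → ℝᴺ` — a topological embedding since `M` is compact. Its point: for every
real-analytic map `e : ℝᵐ → M` and every bounded `ℝ_an,exp`-definable `T ⊆ ℝᵐ`, the image
`F(e(T)) ⊆ ℝᴺ` is `ℝ_an,exp`-definable (`RealAnExpSubanalytic.lean`: the maps `ψⱼ ∘ e` are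
real-analytic on the open sets `e⁻¹(dom ψⱼ)`, hence have definable graphs over finite unions of
closed cubes covering the relevant compact pieces, and `Θ`, `qⱼ` are semialgebraic). No analytic
embedding theorem (Grauert–Morrey) and no partition of unity is needed: only continuity and
definability of `F` matter.

## Main statements (all proved)

* `continuous_of_continuousOn_of_eq_zero`; the profile `Θ` (`continuous_profile`, `profile_eq_one`,
  `profile_eq_zero`, `definable_graph_profile`); `exists_rho`, `chart_bump_data`, `bump_props`
  (one chart bump: continuity, `b = 1` on a neighbourhood of the centre, `b = 0` off a compact subset
  of the chart source); `exists_chart_cover`; `definable_bumpChartRelation` (the first-order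
  description of `F ∘ e`).
* `Literature.Geometry.Manifold.exists_embedding_definable_image` — there are `N` and
  `F : M → ℝᴺ` continuous and injective such that `F(e(T))` is `ℝ_an,exp`-definable for every
  analytic `e : ℝᵐ → M` and every bounded definable `T ⊆ ℝᵐ`.
* `Literature.Geometry.Manifold.exists_definable_homeomorph_of_eq_image` — a closed `C ⊆ M` of the
  form `C = ex(T)`, `ex : E' → M` analytic, `T ⊆ E'` bounded subanalytic, is homeomorphic to a compact
  `ℝ_an,exp`-definable `X ⊆ ℝᴺ`.

Consumer: Buchner 1977 (the cut locus `C(p) = exp_p(TCL(p))` of a compact real-analytic Riemannian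
manifold is homeomorphic to the compact definable set `F(C(p)) = (F ∘ exp_p)(TCL(p))`).

## References

* [Dries1998] L. van den Dries, *Tame topology and o-minimal structures* (1998), Ch. 1 (2.3)
  (Boolean combinations, products, projections of definable sets are definable).
* [Pila2022] J. Pila, *Point-counting and the Zilber–Pink conjecture* (2022), 8.21 (`ℝ_an`).
-/

noncomputable section

open Set Function Filter FirstOrder
open _root_.Topology _root_.Manifold
open scoped ContDiff

namespace Literature.Geometry.Manifold

open Literature.ModelTheory.ExponentialFields

/-! ### Generic topological lemmas -/

section Topology

variable {M : Type*} [TopologicalSpace M]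

/-- A real function continuous on an open set `S` and vanishing off a closed set `K ⊆ S` is
continuous. [folklore] -/
theorem continuous_of_continuousOn_of_eq_zero {f : M → ℝ} {S K : Set M} (hS : IsOpen S)
    (hK : IsClosed K) (hKS : K ⊆ S) (hf : ContinuousOn f S) (h0 : ∀ y ∉ K, f y = 0) :
    Continuous f := by
  refine continuous_iff_continuousAt.2 fun y => ?_
  by_cases hy : y ∈ S
  · exact hf.continuousAt (hS.mem_nhds hy)
  · have hyK : y ∉ K := fun h => hy (hKS h)
    have hev : f =ᶠ[𝓝 y] fun _ => 0 := by
      filter_upwards [hK.isOpen_compl.mem_nhds hyK] with z hz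
      exact h0 z hz
    exact (continuousAt_const.congr hev.symm)

end Topology

/-! ### The bump profile `Θ` and the squared distance `q` -/

section Profile

/-- The piecewise-linear bump profile `Θ(s) = max 0 (min 1 (4(1 - s)/3))`: continuous, `= 1` for
`s ≤ 1/4`, `= 0` for `s ≥ 1`, and `Θ s = 1 → s < 1` etc. We do not name it; the lemmas are about
the explicit expression. Continuity. [folklore] -/
theorem continuous_profile : Continuous fun s : ℝ => max 0 (min 1 (4 * (1 - s) / 3)) := by
  fun_prop

/-- `Θ s = 1` for `s ≤ 1/4`. [folklore] -/
theorem profile_eq_one {s : ℝ} (hs : s ≤ 1 / 4) : max 0 (min 1 (4 * (1 - s) / 3)) = 1 := by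
  have h : 1 ≤ 4 * (1 - s) / 3 := by linarith
  rw [min_eq_left h, max_eq_right zero_le_one]

/-- `Θ s = 0` for `1 ≤ s`. [folklore] -/
theorem profile_eq_zero {s : ℝ} (hs : 1 ≤ s) : max 0 (min 1 (4 * (1 - s) / 3)) = 0 := by
  have h : 4 * (1 - s) / 3 ≤ 0 := by linarith
  rw [min_eq_right (h.trans zero_le_one), max_eq_left h]

/-- If `Θ s = 1` then `s < 1`. [folklore] -/
theorem lt_one_of_profile_eq_one {s : ℝ} (h : max 0 (min 1 (4 * (1 - s) / 3)) = 1) : s < 1 := by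
  by_contra hs
  rw [profile_eq_zero (not_lt.1 hs)] at h
  exact zero_ne_one h

/-- The graph of `Θ` is definable in `ℝ_an,exp` (indeed semialgebraic: three linear pieces).
[cite: Dries1998, Ch. 1 (2.3)] -/
theorem definable_graph_profile :
    (univ : Set ℝ).Definable Language.realAnExp
      {p : Fin 2 → ℝ | p 1 = max 0 (min 1 (4 * (1 - p 0) / 3))} := by
  have key : {p : Fin 2 → ℝ | p 1 = max 0 (min 1 (4 * (1 - p 0) / 3))} =
      {p : Fin 2 → ℝ | (p 0 ≤ 1 / 4 ∧ p 1 = 1) ∨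
        ((1 / 4 < p 0 ∧ p 0 < 1) ∧ 3 * p 1 = 4 * (1 - p 0)) ∨ (1 ≤ p 0 ∧ p 1 = 0)} := by
    ext p
    simp only [mem_setOf_eq]
    constructor
    · intro h
      rcases le_or_gt (p 0) (1 / 4) with h1 | h1
      · exact Or.inl ⟨h1, by rw [h, profile_eq_one h1]⟩
      rcases lt_or_ge (p 0) 1 with h2 | h2
      · refine Or.inr (Or.inl ⟨⟨h1, h2⟩, ?_⟩)
        have hlo : 0 ≤ 4 * (1 - p 0) / 3 := by linarith
        have hhi : 4 * (1 - p 0) / 3 ≤ 1 := by linarith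
        rw [min_eq_right hhi, max_eq_right hlo] at h
        rw [h]
        ring
      · exact Or.inr (Or.inr ⟨h2, by rw [h, profile_eq_zero h2]⟩)
    · rintro (⟨h1, h⟩ | ⟨⟨h1, h2⟩, h⟩ | ⟨h1, h⟩)
      · rw [h, profile_eq_one h1]
      · have hlo : 0 ≤ 4 * (1 - p 0) / 3 := by linarith
        have hhi : 4 * (1 - p 0) / 3 ≤ 1 := by linarith
        rw [min_eq_right hhi, max_eq_right hlo]
        linarith
      · rw [h, profile_eq_zero h1]
  rw [key]
  open Language.realAnExp in
  refine definable_setOf_or (definable_setOf_and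
    (definable_setOf_le' (definableFun_proj _) (definableFun_const' _ _))
    (definable_setOf_eq' (definableFun_proj _) (definableFun_const' _ _))) (definable_setOf_or
    (definable_setOf_and (definable_setOf_and
      (definable_setOf_lt' (definableFun_const' _ _) (definableFun_proj _))
      (definable_setOf_lt' (definableFun_proj _) (definableFun_const' _ _)))
      (definable_setOf_eq' (definableFun_mul (definableFun_const' _ _) (definableFun_proj _))
        (definableFun_mul (definableFun_const' _ _)
          (definableFun_sub (definableFun_const' _ _) (definableFun_proj _)))))
    (definable_setOf_and (definable_setOf_le' (definableFun_const' _ _) (definableFun_proj _))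
      (definable_setOf_eq' (definableFun_proj _) (definableFun_const' _ _))))

variable {n : ℕ}

/-- The squared Euclidean distance to `c`, `q(u) = ∑ (uᵢ - cᵢ)²`, dominates each coordinate:
`(uᵢ - cᵢ)² ≤ q(u)`. [folklore] -/
theorem sq_sub_le_sum_sq (u c : Fin n → ℝ) (i : Fin n) :
    (u i - c i) ^ 2 ≤ ∑ j, (u j - c j) ^ 2 :=
  Finset.single_le_sum (fun j _ => sq_nonneg (u j - c j)) (Finset.mem_univ i)

/-- `{q ≤ ρ²}` lies in the closed sup-ball of radius `ρ`. [folklore] -/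
theorem setOf_sum_sq_le_subset_closedBall (c : Fin n → ℝ) {ρ : ℝ} (hρ : 0 ≤ ρ) :
    {u : Fin n → ℝ | ∑ j, (u j - c j) ^ 2 ≤ ρ ^ 2} ⊆ Metric.closedBall c ρ := by
  intro u hu
  rw [Metric.mem_closedBall, dist_pi_le_iff hρ]
  intro i
  rw [Real.dist_eq]
  have h : (u i - c i) ^ 2 ≤ ρ ^ 2 := (sq_sub_le_sum_sq u c i).trans hu
  exact abs_le_of_sq_le_sq h hρ

/-- `{q ≤ ρ²}` is compact. [folklore] -/
theorem isCompact_setOf_sum_sq_le (c : Fin n → ℝ) {ρ : ℝ} (hρ : 0 ≤ ρ) :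
    IsCompact {u : Fin n → ℝ | ∑ j, (u j - c j) ^ 2 ≤ ρ ^ 2} := by
  refine Metric.isCompact_of_isClosed_isBounded ?_ ?_
  · exact isClosed_le (by fun_prop) continuous_const
  · exact Metric.isBounded_closedBall.subset (setOf_sum_sq_le_subset_closedBall c hρ)

/-- `q` is a definable function of (a sub-tuple of) the variables. [cite: Dries1998, Ch. 1 (2.3)] -/
theorem definableFun_sum_sq {γ : Type*} (τ : Fin n → γ) (c : Fin n → ℝ) :
    (univ : Set ℝ).DefinableFun Language.realAnExp
      (fun v : γ → ℝ => ∑ j, (v (τ j) - c j) ^ 2) := by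
  open Language.realAnExp in
  refine definableFun_sum _ fun j _ => ?_
  have h := definableFun_mul (α := γ)
    (definableFun_sub (definableFun_proj (τ j)) (definableFun_const' _ (c j)))
    (definableFun_sub (definableFun_proj (τ j)) (definableFun_const' _ (c j)))
  simpa [sq] using h

end Profile

/-! ### Chart data -/

section Charts

variable {E : Type*} [NormedAddCommGroup E] [NormedSpace ℝ E] {H : Type*} [TopologicalSpace H]
  (I : ModelWithCorners ℝ E H) {M : Type*} [TopologicalSpace M] [ChartedSpace H M]

/-- Around every point `x` of a boundaryless manifold, read in the extended chart at `x` followed by a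
linear isomorphism `L : E ≃ ℝⁿ`, there is `ρ > 0` with the closed Euclidean ball `{q ≤ ρ²}` around
`L(extChartAt I x x)` inside the (open) chart image `L((extChartAt I x).target)`. [folklore] -/
theorem exists_rho [I.Boundaryless] {n : ℕ} (L : E ≃L[ℝ] (Fin n → ℝ)) (x : M) :
    ∃ ρ : ℝ, 0 < ρ ∧ {u : Fin n → ℝ | ∑ j, (u j - L (extChartAt I x x) j) ^ 2 ≤ ρ ^ 2} ⊆
      L '' (extChartAt I x).target := by
  have hopen : IsOpen (L '' (extChartAt I x).target) :=
    L.toHomeomorph.isOpenMap _ (isOpen_extChartAt_target x)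
  have hmem : L (extChartAt I x x) ∈ L '' (extChartAt I x).target :=
    mem_image_of_mem _ (mem_extChartAt_target x)
  obtain ⟨ε, hε, hball⟩ := Metric.isOpen_iff.1 hopen _ hmem
  refine ⟨ε / 2, half_pos hε, fun u hu => hball ?_⟩
  have h := setOf_sum_sq_le_subset_closedBall (L (extChartAt I x x)) (half_pos hε).le hu
  rw [Metric.mem_closedBall] at h
  rw [Metric.mem_ball]
  linarith

/-- **Chart bump data.** For `x ∈ M` (boundaryless, Hausdorff) and `L : E ≃ ℝⁿ`, with
`ψ = L ∘ extChartAt I x`, `c = ψ x`, `q(u) = ∑ (uᵢ - cᵢ)²` and `ρ` from `exists_rho`: the set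
`K = {y ∈ source | q(ψ y) ≤ ρ²}` is compact and contained in the chart source, and
`W = {y ∈ source | q(ψ y) < ρ²/4}` is an open neighbourhood of `x`. [folklore] -/
theorem chart_bump_data [I.Boundaryless] [T2Space M] {n : ℕ} (L : E ≃L[ℝ] (Fin n → ℝ)) (x : M)
    {ρ : ℝ} (hρ : 0 < ρ)
    (hρsub : {u : Fin n → ℝ | ∑ j, (u j - L (extChartAt I x x) j) ^ 2 ≤ ρ ^ 2} ⊆
      L '' (extChartAt I x).target) :
    IsCompact {y : M | y ∈ (extChartAt I x).source ∧
        ∑ j, (L (extChartAt I x y) j - L (extChartAt I x x) j) ^ 2 ≤ ρ ^ 2} ∧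
      IsOpen {y : M | y ∈ (extChartAt I x).source ∧
        ∑ j, (L (extChartAt I x y) j - L (extChartAt I x x) j) ^ 2 < ρ ^ 2 / 4} ∧
      x ∈ {y : M | y ∈ (extChartAt I x).source ∧
        ∑ j, (L (extChartAt I x y) j - L (extChartAt I x x) j) ^ 2 < ρ ^ 2 / 4} := by
  set c : Fin n → ℝ := L (extChartAt I x x) with hc
  set Q : Set (Fin n → ℝ) := {u | ∑ j, (u j - c j) ^ 2 ≤ ρ ^ 2} with hQ
  have hQc : IsCompact Q := isCompact_setOf_sum_sq_le c hρ.le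
  -- `K` is the image of `Q` under the continuous inverse chart
  have hcont : ContinuousOn (fun u => (extChartAt I x).symm (L.symm u)) (L '' (extChartAt I x).target) := by
    refine (continuousOn_extChartAt_symm x).comp L.symm.continuous.continuousOn fun u hu => ?_
    obtain ⟨v, hv, rfl⟩ := hu
    simpa using hv
  have hKeq : {y : M | y ∈ (extChartAt I x).source ∧
      ∑ j, (L (extChartAt I x y) j - c j) ^ 2 ≤ ρ ^ 2} =
      (fun u => (extChartAt I x).symm (L.symm u)) '' Q := by
    ext y
    simp only [mem_setOf_eq, mem_image]
    constructor
    · rintro ⟨hy, hq⟩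
      refine ⟨L (extChartAt I x y), hq, ?_⟩
      rw [L.symm_apply_apply, (extChartAt I x).left_inv hy]
    · rintro ⟨u, hu, rfl⟩
      obtain ⟨v, hv, rfl⟩ := hρsub hu
      rw [L.symm_apply_apply]
      refine ⟨(extChartAt I x).map_target hv, ?_⟩
      rw [(extChartAt I x).right_inv hv]
      exact hu
  refine ⟨?_, ?_, ?_⟩
  · rw [hKeq]
    exact hQc.image_of_continuousOn (hcont.mono hρsub)
  · have hcont' : ContinuousOn (fun y => ∑ j, (L (extChartAt I x y) j - c j) ^ 2)
        (extChartAt I x).source := by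
      have h1 : ContinuousOn (fun y => L (extChartAt I x y)) (extChartAt I x).source :=
        L.continuous.comp_continuousOn (continuousOn_extChartAt x)
      have h2 : Continuous (fun u : Fin n → ℝ => ∑ j, (u j - c j) ^ 2) := by fun_prop
      exact h2.comp_continuousOn h1
    have h := hcont'.isOpen_inter_preimage (isOpen_extChartAt_source x) (isOpen_Iio (a := ρ ^ 2 / 4))
    convert h using 1
    ext y
    simp only [mem_setOf_eq, mem_inter_iff, mem_preimage, mem_Iio]
  · refine ⟨mem_extChartAt_source x, ?_⟩
    simp only [hc, sub_self, ne_eq, OfNat.ofNat_ne_zero, not_false_eq_true, zero_pow,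
      Finset.sum_const_zero]
    positivity

end Charts

/-! ### The first-order description of the embedding -/

section Relation

open Language.realAnExp

/-- **Definability of the chart description of `F ∘ e`.** Pure first-order bookkeeping: given a
definable `T ⊆ ℝᵐ`, finitely many definable pieces `D x ⊆ ℝᵐ` with definable graphs over `D x` of
maps `f x : ℝᵐ → ℝⁿ`, centres `c x` and constants `r x`, the set of tuples `(z, u)`,
`z : κ × Option (Fin n) → ℝ`, `u ∈ T`, such that for every `x` EITHER `u ∈ D x` and, with
`w = f x u`, `z (x, none) = Θ((∑ (wᵢ - c x i)²) · r x)` and `z (x, some i) = z (x, none) · wᵢ`, OR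
`u ∉ D x` and all `z (x, ·) = 0`, is definable in `ℝ_an,exp`. [cite: Dries1998, Ch. 1 (2.3)] -/
theorem definable_bumpChartRelation {κ : Type*} [Fintype κ] {m n : ℕ}
    {T : Set (Fin m → ℝ)} (hT : (univ : Set ℝ).Definable Language.realAnExp T)
    {D : κ → Set (Fin m → ℝ)} (hD : ∀ x, (univ : Set ℝ).Definable Language.realAnExp (D x))
    (f : κ → (Fin m → ℝ) → (Fin n → ℝ))
    (hVG : ∀ x, (univ : Set ℝ).Definable Language.realAnExp
      {w : Fin m ⊕ Fin n → ℝ | (fun j => w (Sum.inl j)) ∈ D x ∧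
        ∀ i, w (Sum.inr i) = f x (fun j => w (Sum.inl j)) i})
    (c : κ → Fin n → ℝ) (r : κ → ℝ) :
    (univ : Set ℝ).Definable Language.realAnExp
      {v : (κ × Option (Fin n)) ⊕ Fin m → ℝ | (fun j => v (Sum.inr j)) ∈ T ∧ ∀ x : κ,
        ((fun j => v (Sum.inr j)) ∈ D x ∧ ∃ w : Fin n → ℝ,
            ((fun j => v (Sum.inr j)) ∈ D x ∧ ∀ i, w i = f x (fun j => v (Sum.inr j)) i) ∧
            v (Sum.inl (x, none)) =
              max 0 (min 1 (4 * (1 - (∑ i, (w i - c x i) ^ 2) * r x) / 3)) ∧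
            ∀ i, v (Sum.inl (x, some i)) = v (Sum.inl (x, none)) * w i) ∨
        (¬ (fun j => v (Sum.inr j)) ∈ D x ∧ v (Sum.inl (x, none)) = 0 ∧
          ∀ i, v (Sum.inl (x, some i)) = 0)} := by
  refine definable_setOf_and (definable_setOf_comp_mem hT Sum.inr) ?_
  refine definable_setOf_forall_index fun x => definable_setOf_or ?_ ?_
  · refine definable_setOf_and (definable_setOf_comp_mem (hD x) Sum.inr) ?_
    refine definable_setOf_exists_fin
      (P := fun (v : (κ × Option (Fin n)) ⊕ Fin m → ℝ) (w : Fin n → ℝ) =>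
        ((fun j => v (Sum.inr j)) ∈ D x ∧ ∀ i, w i = f x (fun j => v (Sum.inr j)) i) ∧
          v (Sum.inl (x, none)) =
            max 0 (min 1 (4 * (1 - (∑ i, (w i - c x i) ^ 2) * r x) / 3)) ∧
          ∀ i, v (Sum.inl (x, some i)) = v (Sum.inl (x, none)) * w i) ?_
    refine definable_setOf_and ?_ (definable_setOf_and ?_ ?_)
    · -- the graph of `f x` over `D x`, re-indexed
      have h := definable_setOf_comp_mem (hVG x)
        (Sum.elim (fun j => Sum.inl (Sum.inr j)) Sum.inr :
          Fin m ⊕ Fin n → ((κ × Option (Fin n)) ⊕ Fin m) ⊕ Fin n)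
      exact h
    · -- `z (x, none) = Θ(q(w) r)`
      exact definable_setOf_rel (r := fun s t => t = max 0 (min 1 (4 * (1 - s) / 3)))
        definable_graph_profile
        (definableFun_mul (definableFun_sum_sq (fun i => Sum.inr i) (c x))
          (definableFun_const' _ _))
        (definableFun_proj _)
    · exact definable_setOf_forall_index fun i =>
        definable_setOf_eq' (definableFun_proj _)
          (definableFun_mul (definableFun_proj _) (definableFun_proj _))
  · exact definable_setOf_and (definable_setOf_not (definable_setOf_comp_mem (hD x) Sum.inr))
      (definable_setOf_and (definable_setOf_eq' (definableFun_proj _) (definableFun_const' _ _))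
        (definable_setOf_forall_index fun i =>
          definable_setOf_eq' (definableFun_proj _) (definableFun_const' _ _)))

end Relation

/-! ### The embedding -/

section Embedding

variable {E : Type*} [NormedAddCommGroup E] [NormedSpace ℝ E]
  {H : Type*} [TopologicalSpace H] (I : ModelWithCorners ℝ E H) [I.Boundaryless]
  {M : Type*} [TopologicalSpace M] [ChartedSpace H M] [CompactSpace M] [T2Space M]

/-- **A continuous injective map `F : M → ℝᴺ` from finitely many charts and semialgebraic bumps,
together with its chart description.** There are finitely many centres `xⱼ`, radii `ρⱼ > 0` and a
linear isomorphism `L : E ≃ ℝⁿ` such that, with `ψⱼ = L ∘ extChartAt I xⱼ`, `cⱼ = ψⱼ xⱼ`,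
`qⱼ(u) = ∑ (uᵢ - cⱼᵢ)²`, `bⱼ(y) = Θ(qⱼ(ψⱼ y)/ρⱼ²)` on the chart source and `0` outside, the map
`F y = (bⱼ y, bⱼ y · ψⱼ y)ⱼ` is continuous and injective. Stated as the existence of the data with
the listed properties (the sets `{qⱼ ∘ ψⱼ ≤ ρⱼ²} ∩ source` compact, the sets
`{qⱼ ∘ ψⱼ < ρⱼ²/4} ∩ source` covering `M`). [folklore] -/
theorem exists_chart_cover (n : ℕ) (L : E ≃L[ℝ] (Fin n → ℝ)) :
    ∃ (t : Finset M) (ρ : M → ℝ), (∀ x, 0 < ρ x) ∧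
      (∀ x, {u : Fin n → ℝ | ∑ j, (u j - L (extChartAt I x x) j) ^ 2 ≤ ρ x ^ 2} ⊆
        L '' (extChartAt I x).target) ∧
      (∀ y : M, ∃ x ∈ t, y ∈ (extChartAt I x).source ∧
        ∑ j, (L (extChartAt I x y) j - L (extChartAt I x x) j) ^ 2 < ρ x ^ 2 / 4) := by
  classical
  have hρ : ∀ x : M, ∃ ρ : ℝ, 0 < ρ ∧
      {u : Fin n → ℝ | ∑ j, (u j - L (extChartAt I x x) j) ^ 2 ≤ ρ ^ 2} ⊆
        L '' (extChartAt I x).target := fun x => exists_rho I L x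
  choose ρ hρ0 hρsub using hρ
  set W : M → Set M := fun x => {y : M | y ∈ (extChartAt I x).source ∧
    ∑ j, (L (extChartAt I x y) j - L (extChartAt I x x) j) ^ 2 < ρ x ^ 2 / 4} with hW
  have hWo : ∀ x, IsOpen (W x) := fun x => (chart_bump_data I L x (hρ0 x) (hρsub x)).2.1
  have hWx : ∀ x, x ∈ W x := fun x => (chart_bump_data I L x (hρ0 x) (hρsub x)).2.2
  obtain ⟨t, ht⟩ := isCompact_univ.elim_finite_subcover W hWo fun y _ => mem_iUnion.2 ⟨y, hWx y⟩
  refine ⟨t, ρ, hρ0, hρsub, fun y => ?_⟩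
  obtain ⟨x, hx, hy⟩ := mem_iUnion₂.1 (ht (mem_univ y))
  exact ⟨x, hx, hy⟩

omit [CompactSpace M] in
/-- **Properties of one chart bump** `b(y) = Θ(q(ψ y)/ρ²)` on the chart source, `0` outside (`b` is
passed with its defining equation): `b` and the `b · ψᵢ` are continuous on `M`, `b = 1` forces the
chart source, `b = 1` on `W = {q ∘ ψ < ρ²/4}`, and `b = 0` off `K = {q ∘ ψ ≤ ρ²} ∩ source`.
[folklore] -/
theorem bump_props {n : ℕ} (L : E ≃L[ℝ] (Fin n → ℝ)) (x : M) {ρ : ℝ} (hρ : 0 < ρ)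
    (hρsub : {u : Fin n → ℝ | ∑ j, (u j - L (extChartAt I x x) j) ^ 2 ≤ ρ ^ 2} ⊆
      L '' (extChartAt I x).target)
    {b : M → ℝ} (hb : ∀ y, b y = (extChartAt I x).source.indicator (fun y =>
      max 0 (min 1 (4 * (1 - (∑ j, (L (extChartAt I x y) j - L (extChartAt I x x) j) ^ 2) *
        (ρ ^ 2)⁻¹) / 3))) y) :
    Continuous b ∧ (∀ i, Continuous fun y => b y * L (extChartAt I x y) i) ∧
      (∀ y, b y = 1 → y ∈ (extChartAt I x).source) ∧
      (∀ y, y ∈ (extChartAt I x).source →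
        ∑ j, (L (extChartAt I x y) j - L (extChartAt I x x) j) ^ 2 < ρ ^ 2 / 4 → b y = 1) ∧
      (∀ y, ¬ (y ∈ (extChartAt I x).source ∧
        ∑ j, (L (extChartAt I x y) j - L (extChartAt I x x) j) ^ 2 ≤ ρ ^ 2) → b y = 0) := by
  set c : Fin n → ℝ := L (extChartAt I x x) with hc
  have hρ2 : 0 < ρ ^ 2 := by positivity
  have hK := (chart_bump_data I L x hρ hρsub).1
  have hKc : IsClosed {y : M | y ∈ (extChartAt I x).source ∧
      ∑ j, (L (extChartAt I x y) j - c j) ^ 2 ≤ ρ ^ 2} := hK.isClosed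
  -- vanishing off `K`
  have h0 : ∀ y, ¬ (y ∈ (extChartAt I x).source ∧
      ∑ j, (L (extChartAt I x y) j - c j) ^ 2 ≤ ρ ^ 2) → b y = 0 := by
    intro y hy
    rw [hb y]
    by_cases hys : y ∈ (extChartAt I x).source
    · rw [indicator_of_mem hys]
      have hq : ρ ^ 2 < ∑ j, (L (extChartAt I x y) j - c j) ^ 2 := by
        by_contra h
        exact hy ⟨hys, not_lt.1 h⟩
      refine profile_eq_zero ?_
      rw [← div_eq_mul_inv, le_div_iff₀ hρ2, one_mul]
      exact hq.le
    · rw [indicator_of_notMem hys]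
  -- continuity on the source
  have hψc : ContinuousOn (fun y => L (extChartAt I x y)) (extChartAt I x).source :=
    L.continuous.comp_continuousOn (continuousOn_extChartAt x)
  have hqc : ContinuousOn (fun y => ∑ j, (L (extChartAt I x y) j - c j) ^ 2)
      (extChartAt I x).source := by
    have h2 : Continuous (fun u : Fin n → ℝ => ∑ j, (u j - c j) ^ 2) := by fun_prop
    exact h2.comp_continuousOn hψc
  have hbS : ContinuousOn b (extChartAt I x).source := by
    have h1 : ContinuousOn (fun y => max 0 (min 1 (4 * (1 -
        (∑ j, (L (extChartAt I x y) j - c j) ^ 2) * (ρ ^ 2)⁻¹) / 3))) (extChartAt I x).source := by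
      have h3 : Continuous (fun s : ℝ => max 0 (min 1 (4 * (1 - s * (ρ ^ 2)⁻¹) / 3))) := by
        fun_prop
      exact h3.comp_continuousOn hqc
    refine h1.congr fun y hy => ?_
    rw [hb y, indicator_of_mem hy]
  have hbc : Continuous b :=
    continuous_of_continuousOn_of_eq_zero (isOpen_extChartAt_source x) hKc (fun y hy => hy.1) hbS
      (fun y hy => h0 y hy)
  refine ⟨hbc, fun i => ?_, fun y hy => ?_, fun y hy hq => ?_, h0⟩
  · refine continuous_of_continuousOn_of_eq_zero (isOpen_extChartAt_source x) hKc (fun y hy => hy.1)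
      (hbc.continuousOn.mul (((continuous_apply i).comp_continuousOn hψc))) fun y hy => ?_
    rw [h0 y hy, zero_mul]
  · by_contra hys
    rw [hb y, indicator_of_notMem hys] at hy
    exact zero_ne_one hy
  · rw [hb y, indicator_of_mem hy]
    refine profile_eq_one ?_
    rw [← div_eq_mul_inv, div_le_iff₀ hρ2]
    linarith

/-- **The embedding theorem.** For a compact Hausdorff boundaryless real-analytic manifold `M` there
are `N` and a continuous injective `F : M → ℝᴺ` (hence a topological embedding) such that for every
real-analytic `e : ℝᵐ → M` and every bounded `ℝ_an,exp`-definable `T ⊆ ℝᵐ` the image `F(e(T))` is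
`ℝ_an,exp`-definable. (`F = (bⱼ, bⱼ ψⱼ)ⱼ` from finitely many charts `ψⱼ` and semialgebraic bumps
`bⱼ`; `ψⱼ ∘ e` is analytic where defined, so its graph over finitely many closed cubes covering the
relevant compact set is definable, and `F ∘ e` has a first-order description there.)
[cite: Pila2022, 8.21] -/
theorem exists_embedding_definable_image [FiniteDimensional ℝ E] [IsManifold I ω M] :
    ∃ (N : ℕ) (F : M → (Fin N → ℝ)), Continuous F ∧ Injective F ∧
      ∀ (m : ℕ) (e : (Fin m → ℝ) → M), ContMDiff 𝓘(ℝ, Fin m → ℝ) I ω e →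
        ∀ T : Set (Fin m → ℝ), (univ : Set ℝ).Definable Language.realAnExp T →
          Bornology.IsBounded T →
            (univ : Set ℝ).Definable Language.realAnExp ((F ∘ e) '' T) := by
  classical
  -- coordinates on `E`
  set n : ℕ := Module.finrank ℝ E with hn
  have hdim : Module.finrank ℝ E = Module.finrank ℝ (Fin n → ℝ) := by
    rw [Module.finrank_fin_fun]
  set L : E ≃L[ℝ] (Fin n → ℝ) := ContinuousLinearEquiv.ofFinrankEq hdim with hL
  obtain ⟨t, ρ, hρ0, hρsub, hcov⟩ := exists_chart_cover (M := M) I n L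
  -- the bumps
  set b : M → M → ℝ := fun x y => (extChartAt I x).source.indicator (fun y =>
      max 0 (min 1 (4 * (1 - (∑ j, (L (extChartAt I x y) j - L (extChartAt I x x) j) ^ 2) *
        (ρ x ^ 2)⁻¹) / 3))) y with hbdef
  have hbp := fun x : M => bump_props I L x (hρ0 x) (hρsub x) (b := b x) (fun y => rfl)
  -- the map
  set F₀ : M → (↥t × Option (Fin n) → ℝ) := fun y k =>
    Option.elim k.2 (b k.1 y) (fun i => b k.1 y * L (extChartAt I (k.1 : M) y) i) with hF₀
  set N : ℕ := Fintype.card (↥t × Option (Fin n)) with hN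
  set eqv : (↥t × Option (Fin n)) ≃ Fin N := Fintype.equivFin _ with heqv
  set F : M → (Fin N → ℝ) := fun y l => F₀ y (eqv.symm l) with hF
  have hF₀c : ∀ k, Continuous fun y => F₀ y k := by
    rintro ⟨x, _ | i⟩
    · simpa [hF₀] using (hbp x).1
    · simpa [hF₀] using (hbp x).2.1 i
  have hFc : Continuous F := continuous_pi fun l => hF₀c (eqv.symm l)
  have hF₀inj : ∀ y y', F₀ y = F₀ y' → y = y' := by
    intro y y' h
    obtain ⟨x, hxt, hys, hq⟩ := hcov y
    have hb1 : b x y = 1 := (hbp x).2.2.2.1 y hys hq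
    have hnone := congr_fun h (⟨x, hxt⟩, none)
    simp only [hF₀, Option.elim] at hnone
    have hb1' : b x y' = 1 := by rw [← hnone, hb1]
    have hys' : y' ∈ (extChartAt I x).source := (hbp x).2.2.1 y' hb1'
    have hψ : L (extChartAt I x y) = L (extChartAt I x y') := by
      funext i
      have hi := congr_fun h (⟨x, hxt⟩, some i)
      simp only [hF₀, Option.elim] at hi
      rwa [hb1, hb1', one_mul, one_mul] at hi
    exact (extChartAt I x).injOn hys hys' (L.injective hψ)
  have hFinj : Injective F := by
    intro y y' h
    refine hF₀inj y y' (funext fun k => ?_)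
    have := congr_fun h (eqv k)
    simpa [hF] using this
  refine ⟨N, F, hFc, hFinj, fun m e he T hT hTb => ?_⟩
  -- analyticity of `e` read in the charts
  have han : ∀ (x : M) (i : Fin n), AnalyticOnNhd ℝ (fun u => L (extChartAt I x (e u)) i)
      (e ⁻¹' (extChartAt I x).source) := by
    intro x i u hu
    have hUo : IsOpen (e ⁻¹' (extChartAt I x).source) :=
      (isOpen_extChartAt_source x).preimage he.continuous
    have h1 : ContMDiffOn 𝓘(ℝ, Fin m → ℝ) 𝓘(ℝ, E) ω (fun u => extChartAt I x (e u))
        (e ⁻¹' (extChartAt I x).source) :=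
      (contMDiffOn_extChartAt (x := x)).comp he.contMDiffOn fun u hu => by
        simpa only [extChartAt_source] using hu
    have h2 : ContDiffOn ℝ ω (fun u => extChartAt I x (e u)) (e ⁻¹' (extChartAt I x).source) :=
      contMDiffOn_iff_contDiffOn.1 h1
    have h3 : AnalyticAt ℝ (fun u => extChartAt I x (e u)) u :=
      ((h2 u hu).contDiffAt (hUo.mem_nhds hu)).analyticAt
    exact (((ContinuousLinearMap.proj i : (Fin n → ℝ) →L[ℝ] ℝ).comp
      (L : E →L[ℝ] (Fin n → ℝ))).analyticAt _).comp h3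
  -- a compact set containing `T`, and the pieces `C x ⊆ e⁻¹(source x)`
  obtain ⟨R, hR⟩ := hTb.subset_closedBall 0
  have hB : IsCompact (Metric.closedBall (0 : Fin m → ℝ) R) := isCompact_closedBall 0 R
  have hKdef : ∀ x : M, IsCompact {y : M | y ∈ (extChartAt I x).source ∧
      ∑ j, (L (extChartAt I x y) j - L (extChartAt I x x) j) ^ 2 ≤ ρ x ^ 2} :=
    fun x => (chart_bump_data I L x (hρ0 x) (hρsub x)).1
  have hD : ∀ x : M, ∃ D : Set (Fin m → ℝ),
      Metric.closedBall (0 : Fin m → ℝ) R ∩ e ⁻¹' {y : M | y ∈ (extChartAt I x).source ∧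
        ∑ j, (L (extChartAt I x y) j - L (extChartAt I x x) j) ^ 2 ≤ ρ x ^ 2} ⊆ D ∧
      D ⊆ e ⁻¹' (extChartAt I x).source ∧ IsCompact D ∧
      (univ : Set ℝ).Definable Language.realAnExp D ∧
      ∀ f : (Fin m → ℝ) → ℝ, AnalyticOnNhd ℝ f (e ⁻¹' (extChartAt I x).source) →
        (univ : Set ℝ).Definable Language.realAnExp
          {v : Fin (m + 1) → ℝ | Fin.init v ∈ D ∧ v (Fin.last m) = f (Fin.init v)} := by
    intro x
    refine Language.realAnExp.exists_boxes_definable_graphOn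
      ((isOpen_extChartAt_source x).preimage he.continuous)
      (hB.inter_right ((hKdef x).isClosed.preimage he.continuous)) ?_
    rintro u ⟨-, hu⟩
    exact hu.1
  choose D hCD hDO _ hDdef hDgraph using hD
  -- the vector graphs of `ψ x ∘ e` over `D x`
  have hVG : ∀ x : ↥t, (univ : Set ℝ).Definable Language.realAnExp
      {w : Fin m ⊕ Fin n → ℝ | (fun j => w (Sum.inl j)) ∈ D x ∧
        ∀ i, w (Sum.inr i) = L (extChartAt I (x : M) (e (fun j => w (Sum.inl j)))) i} :=
    fun x => Language.realAnExp.definable_vectorGraphOn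
      (h := fun u i => L (extChartAt I (x : M) (e u)) i) (hDdef x) fun i => hDgraph x _ (han x i)
  have hREL := definable_bumpChartRelation (κ := ↥t) hT (fun x : ↥t => hDdef x)
    (fun (x : ↥t) u i => L (extChartAt I (x : M) (e u)) i) hVG
    (fun x : ↥t => L (extChartAt I (x : M) x)) (fun x : ↥t => (ρ x ^ 2)⁻¹)
  -- the first-order description is correct on the closed ball
  have hrel : ∀ u ∈ Metric.closedBall (0 : Fin m → ℝ) R, ∀ z : ↥t × Option (Fin n) → ℝ,
      (∀ x : ↥t,
        ((u ∈ D x ∧ ∃ w : Fin n → ℝ,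
            (u ∈ D x ∧ ∀ i, w i = L (extChartAt I (x : M) (e u)) i) ∧
            z (x, none) =
              max 0 (min 1 (4 * (1 - (∑ i, (w i - L (extChartAt I (x : M) x) i) ^ 2) *
                (ρ x ^ 2)⁻¹) / 3)) ∧
            ∀ i, z (x, some i) = z (x, none) * w i) ∨
        (¬ u ∈ D x ∧ z (x, none) = 0 ∧ ∀ i, z (x, some i) = 0))) ↔ z = F₀ (e u) := by
    intro u hu z
    -- off `D x` the bump vanishes at `e u`
    have hoff : ∀ x : ↥t, u ∉ D x → b x (e u) = 0 := by
      intro x hx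
      refine (hbp x).2.2.2.2 (e u) fun h => hx (hCD x ⟨hu, h⟩)
    constructor
    · intro h
      funext k
      obtain ⟨x, o⟩ := k
      rcases h x with ⟨hxD, w, ⟨-, hw⟩, hz0, hzi⟩ | ⟨hxD, hz0, hzi⟩
      · have hsrc : e u ∈ (extChartAt I (x : M)).source := hDO x hxD
        have hw' : w = L (extChartAt I (x : M) (e u)) := funext hw
        have hb0 : b x (e u) = z (x, none) := by
          rw [hz0, hbdef]
          simp only [indicator_of_mem hsrc, hw']
        cases o with
        | none => simp [hF₀, hb0]
        | some i => simp [hF₀, hzi i, hb0, hw']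
      · cases o with
        | none => simp [hF₀, hz0, hoff x hxD]
        | some i => simp [hF₀, hzi i, hoff x hxD]
    · rintro rfl x
      by_cases hxD : u ∈ D x
      · have hsrc : e u ∈ (extChartAt I (x : M)).source := hDO x hxD
        refine Or.inl ⟨hxD, L (extChartAt I (x : M) (e u)), ⟨hxD, fun i => rfl⟩, ?_, fun i => ?_⟩
        · simp only [hF₀, Option.elim, hbdef, indicator_of_mem hsrc]
        · simp only [hF₀, Option.elim]
      · exact Or.inr ⟨hxD, by simp [hF₀, hoff x hxD], fun i => by simp [hF₀, hoff x hxD]⟩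
  -- hence `F(e(T))` is the projection of the described set, re-indexed by `eqv`
  have hTB : T ⊆ Metric.closedBall (0 : Fin m → ℝ) R := hR
  set S₀ : Set (↥t × Option (Fin n) → ℝ) := {z | ∃ u : Fin m → ℝ, u ∈ T ∧ ∀ x : ↥t,
        ((u ∈ D x ∧ ∃ w : Fin n → ℝ,
            (u ∈ D x ∧ ∀ i, w i = L (extChartAt I (x : M) (e u)) i) ∧
            z (x, none) =
              max 0 (min 1 (4 * (1 - (∑ i, (w i - L (extChartAt I (x : M) x) i) ^ 2) *
                (ρ x ^ 2)⁻¹) / 3)) ∧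
            ∀ i, z (x, some i) = z (x, none) * w i) ∨
        (¬ u ∈ D x ∧ z (x, none) = 0 ∧ ∀ i, z (x, some i) = 0))} with hS₀
  have hS₀def : (univ : Set ℝ).Definable Language.realAnExp S₀ := by
    rw [hS₀]
    exact definable_setOf_exists_fin (P := fun (z : ↥t × Option (Fin n) → ℝ) (u : Fin m → ℝ) =>
      u ∈ T ∧ ∀ x : ↥t,
        ((u ∈ D x ∧ ∃ w : Fin n → ℝ,
            (u ∈ D x ∧ ∀ i, w i = L (extChartAt I (x : M) (e u)) i) ∧
            z (x, none) =
              max 0 (min 1 (4 * (1 - (∑ i, (w i - L (extChartAt I (x : M) x) i) ^ 2) *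
                (ρ x ^ 2)⁻¹) / 3)) ∧
            ∀ i, z (x, some i) = z (x, none) * w i) ∨
        (¬ u ∈ D x ∧ z (x, none) = 0 ∧ ∀ i, z (x, some i) = 0))) hREL
  have himage : (F ∘ e) '' T = (fun g : Fin N → ℝ => g ∘ eqv) ⁻¹' S₀ := by
    ext z'
    rw [mem_preimage, hS₀, mem_setOf_eq, mem_image]
    constructor
    · rintro ⟨u, huT, rfl⟩
      refine ⟨u, huT, (hrel u (hTB huT) ((F ∘ e) u ∘ ⇑eqv)).2 ?_⟩
      funext k
      simp only [Function.comp_apply, hF, Equiv.symm_apply_apply]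
    · rintro ⟨u, huT, h⟩
      refine ⟨u, huT, ?_⟩
      have hz : (z' ∘ ⇑eqv) = F₀ (e u) := (hrel u (hTB huT) (z' ∘ ⇑eqv)).1 h
      funext l
      have := congr_fun hz (eqv.symm l)
      simpa [hF] using this.symm
  rw [himage]
  exact hS₀def.preimage_comp _

/-- **Analytically parametrised closed subsets of a compact analytic manifold are homeomorphic to
compact `ℝ_an,exp`-definable subsets of `ℝᴺ`.** If `C ⊆ M` is closed and `C = ex(T)` for a
real-analytic `ex : E' → M` (`E'` finite-dimensional) and a BOUNDED SUBANALYTIC `T ⊆ E'`, then `C` is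
homeomorphic to a compact `ℝ_an,exp`-definable `X ⊆ ℝᴺ` (namely `X = F(C) = (F ∘ ex)(T)` for the
embedding `F` of `exists_embedding_definable_image`, `T` being definable by
`IsSubanalytic.definable_realAnExp_image`). The cut locus `C(p) = exp_p(TCL(p))` is the case in
point. [cite: Pila2022, 8.21] -/
theorem exists_definable_homeomorph_of_eq_image [FiniteDimensional ℝ E] [IsManifold I ω M]
    {E' : Type*} [NormedAddCommGroup E'] [NormedSpace ℝ E'] [FiniteDimensional ℝ E']
    {ex : E' → M} (hex : ContMDiff 𝓘(ℝ, E') I ω ex) {T : Set E'} (hT : IsSubanalytic T)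
    (hTb : Bornology.IsBounded T) {C : Set M} (hC : IsClosed C) (hCT : C = ex '' T) :
    ∃ (N : ℕ) (X : Set (Fin N → ℝ)), IsCompact X ∧
      (univ : Set ℝ).Definable Language.realAnExp X ∧ Nonempty (C ≃ₜ X) := by
  -- coordinates on `E'`
  set m : ℕ := Module.finrank ℝ E' with hm
  have hdim : Module.finrank ℝ E' = Module.finrank ℝ (Fin m → ℝ) := by
    rw [Module.finrank_fin_fun]
  set L' : E' ≃L[ℝ] (Fin m → ℝ) := ContinuousLinearEquiv.ofFinrankEq hdim with hL'
  obtain ⟨N, F, hFc, hFinj, hFdef⟩ := exists_embedding_definable_image (M := M) I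
  set e : (Fin m → ℝ) → M := fun u => ex (L'.symm u) with he
  have hea : ContMDiff 𝓘(ℝ, Fin m → ℝ) I ω e :=
    hex.comp (contMDiff_iff_contDiff.2 (L'.symm : (Fin m → ℝ) →L[ℝ] E').contDiff)
  have hTdef : (univ : Set ℝ).Definable Language.realAnExp (L' '' T) :=
    hT.definable_realAnExp_image hTb L'
  have hTb' : Bornology.IsBounded (L' '' T) := L'.lipschitz.isBounded_image hTb
  have hX : (F ∘ e) '' (L' '' T) = F '' C := by
    rw [hCT, image_image, image_image]
    refine image_congr fun v _ => ?_
    simp [he]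
  refine ⟨N, F '' C, (hC.isCompact.image hFc), hX ▸ hFdef m e hea _ hTdef hTb', ⟨?_⟩⟩
  -- `C ≃ₜ F(C)` through the closed embedding `F`
  have hemb : IsEmbedding (F ∘ ((↑) : C → M)) :=
    (hFc.isClosedEmbedding hFinj).isEmbedding.comp IsEmbedding.subtypeVal
  exact hemb.toHomeomorph.trans (Homeomorph.setCongr (image_eq_range F C).symm)

end Embedding

end Literature.Geometry.Manifold
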